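import Summits.CriticalPhenomena.PercolationContinuityZ3.Theorems.PercNearOneGluingNoHeavyLowerTailSwitchRelaxCheckN
import Summits.CriticalPhenomena.PercolationContinuityZ3.Theorems.PercNearOneGluingNoHeavyLowerTailSwitchRelaxExpectation
import HarnessLib

/-!
# `NoHeavyLowerTail` (stmt-CriticalPhenomena-4575) — the FINITE RELAXATION of three-copy switching certificates, IId:
# SOUNDNESS of the scalable kernel checker

Support file (prover prim-cert-2 gen 12; `--supports stmt-CriticalPhenomena-4575`).  No named facts, no sorries.

`Cert.soundN`: well-formedness + (tables tabulate the potentials) + coverage + the pair condition at all 15 input types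
imply `Sreal τ c x ≤ 0` at every configuration triple of every finite graph — through the bridges of part IIc and the
semantic facts of part I exactly as in `Cert.sound` of part II: the real per-copy state is generated (`realStN_mem_statesN`),
the representatives of the real output types are listed (`rep_mem_outsY` / `rep_mem_outsZ`, from `admClean_ftype` /
`admMessy_ftype`), the coded value dominates the real sum of potentials (`sumLam_le_sumBestM`, decoding by `encOuts_cons_mod`
/ `encOuts_cons_div` and `unmix_mix`).  `Cert.OkAt` packages what a certificate file proves per input type (by
`decide +kernel` on literal code lists); `ES_nonpos_of_Sreal` feeds the conclusion to part III (`…SwitchRelaxExpectation`).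
-/

namespace Summit.CriticalPhenomena.PercolationContinuityZ3.Theorems

namespace SwitchRelax

open Finset Literature.Probability.Percolation Literature.Probability.Percolation.DecisionTree
open Literature.Probability.Percolation.Gladkov ThreePointLB GroupThreePointLB FourPointAtoms

/-! ### Soundness -/

section Real

variable {V : Type*} [Fintype V] [DecidableEq V] (τ : Fin 4 → V)

/-- The real state of copy `T`, coded by indices. [this work] -/
noncomputable def realStN (c : Cert) (X T : Finset (Sym2 V)) : ℕ × List ℕ :=
  ((ftype τ T).val, c.RS.map fun U => (realP τ X T U).val)

/-- Monotonicity between real avoidance types (from part I). [this work] -/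
theorem refinesN_realP {X T : Finset (Sym2 V)} {U U' : Finset (Fin 4)} (h : maskLE (ftype τ X) U U' = true) :
    refinesN (J (realP τ X T U')) (J (realP τ X T U)) = true :=
  refinesN_of_refines (refines_ftype_of_subset τ (Finset.sdiff_subset_sdiff subset_rfl
    (touch_mono (clS_roots_subset_of_mask τ (of_decide_eq_true h)))))

/-- `pairOKN` holds for the real avoidance types. [this work] -/
theorem pairOKN_real (X T : Finset (Sym2 V)) (U : Finset (Fin 4)) :
    ∀ RSd : List (Finset (Fin 4)),
      pairOKN (ftype τ X) U (realP τ X T U).val RSd (RSd.map fun U' => (realP τ X T U').val) = true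
  | [] => rfl
  | U' :: RSd => by
    simp only [List.map_cons, pairOKN, Bool.and_eq_true, Bool.or_eq_true, Bool.not_eq_true', jt_val]
    refine ⟨⟨?_, ?_⟩, pairOKN_real X T U RSd⟩
    · by_cases h : maskLE (ftype τ X) U U' = true
      · exact Or.inr (refinesN_realP τ h)
      · exact Or.inl (by simpa using h)
    · by_cases h : maskLE (ftype τ X) U' U = true
      · exact Or.inr (refinesN_realP τ h)
      · exact Or.inl (by simpa using h)

/-- The real avoidance type is a candidate. [this work] -/
theorem realP_mem_candsN (X T : Finset (Sym2 V)) (U : Finset (Fin 4)) :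
    (realP τ X T U).val ∈ candsN (ftype τ X) (ftype τ T).val U := by
  refine List.mem_filter.2 ⟨mem_idxs _, ?_⟩
  rw [jt_val, jt_val, Bool.and_eq_true]
  refine ⟨refinesN_of_refines (refines_ftype_of_subset τ Finset.sdiff_subset), rootOKN_of_rootOK ?_⟩
  rw [rootOK, decide_eq_true_iff]
  exact fun i j hi hij => rootBlock_ftype τ X T U i j hi hij

/-- The real tuple is valid. [this work] -/
theorem validN_real (X T : Finset (Sym2 V)) :
    ∀ (rest RSd : List (Finset (Fin 4))),
      validN (ftype τ X) (ftype τ T).val RSd (RSd.map fun U' => (realP τ X T U').val) rest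
        (rest.map fun U' => (realP τ X T U').val)
  | [], _ => rfl
  | U :: rest, RSd => by
    refine ⟨(realP τ X T U).val, rest.map fun U' => (realP τ X T U').val, rfl, realP_mem_candsN τ X T U,
      pairOKN_real τ X T U RSd, ?_⟩
    have h := validN_real X T rest (RSd ++ [U])
    rwa [List.map_append, List.map_singleton] at h

/-- **The real state is generated.** [this work] -/
theorem realStN_mem_statesN (c : Cert) (X T : Finset (Sym2 V)) : realStN τ c X T ∈ c.statesN (ftype τ X) := by
  simp only [Cert.statesN, Cert.statesNtk, List.mem_flatMap, List.mem_map, realStN]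
  exact ⟨(ftype τ T).val, mem_idxs _, _, genN_complete _ _ _ _ _ _ (validN_real τ X T c.RS []), rfl⟩

/-- Indexing a mapped list at a position holding `a`. [folklore] -/
theorem getN_map_of_getElem? {α β : Type} (f : α → β) (d : β) :
    ∀ (l : List α) (i : ℕ) {a : α}, l[i]? = some a → getN (l.map f) i d = f a
  | [], i, a, h => by simp at h
  | b :: l, 0, a, h => by simp only [List.getElem?_cons_zero, Option.some.injEq] at h; subst h; rfl
  | b :: l, i + 1, a, h => by rw [List.getElem?_cons_succ] at h; exact getN_map_of_getElem? f d l i h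

/-- Lookup in the real tuple. [this work] -/
theorem getN_realStN (c : Cert) (X T : Finset (Sym2 V)) {i : ℕ} {U : Finset (Fin 4)} (h : c.RS[i]? = some U) :
    getN (c.RS.map fun U' => (realP τ X T U').val) i 0 = (realP τ X T U).val :=
  getN_map_of_getElem? _ _ c.RS i h

/-- Members of representative lists are indices. [this work] -/
theorem lt_of_mem_map_rep {rep : ℕ → ℕ} (hrep : ∀ q, q < 15 → rep q < 15) {L : List ℕ} (hL : ∀ q ∈ L, q ∈ idxs)
    {q : ℕ} (hq : q ∈ L.map rep) : q < 15 := by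
  obtain ⟨q0, hq0, rfl⟩ := List.mem_map.1 hq
  exact hrep q0 (lt_of_mem_idxs (hL q0 hq0))

/-- Members of `outsY` are indices. [this work] -/
theorem outsY_lt (πX : Ty) (p : Prog) (T : List (List ℤ)) {tk : ℕ} (htk : tk < 15) (ps : List ℕ) :
    ∀ q ∈ outsY πX p T tk ps, q < 15 := by
  intro q hq
  unfold outsY at hq
  have hrep : ∀ q, q < 15 → rowRepN T q < 15 := fun q h => rowRepN_lt T h
  have hfilt : ∀ (P : ℕ → Bool), ∀ q ∈ idxs.filter P, q ∈ idxs := fun P q h => (List.mem_filter.1 h).1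
  -- every table entry is a `map rep` of a filter of `idxs`, or the default `[]`, or a singleton representative
  have hclean : ∀ (jX w k : ℕ), ∀ q ∈ getN (cleanTabN jX w (rowRepN T)) k [], q < 15 := by
    intro jX w k q hq
    by_cases hk : k < 15
    · rw [cleanTabN, show k = (⟨k, hk⟩ : Ty).val from rfl, getN_idxs_map] at hq
      exact lt_of_mem_map_rep hrep (hfilt _) hq
    · have : getN (cleanTabN jX w (rowRepN T)) k ([] : List ℕ) = [] := by
        rw [cleanTabN]; simp only [idxs, List.map]
        match k, hk with
        | n + 15, _ => simp [getN]
      rw [this] at hq; simp at hq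
  have hmessy : ∀ (jX w v k : ℕ), ∀ q ∈ getN (getN (messyTabN jX w v (rowRepN T)) tk []) k [], q < 15 := by
    intro jX w v k q hq
    rw [messyTabN, show tk = (⟨tk, htk⟩ : Ty).val from rfl, getN_idxs_map] at hq
    by_cases hk : k < 15
    · rw [show k = (⟨k, hk⟩ : Ty).val from rfl, getN_idxs_map] at hq
      exact lt_of_mem_map_rep hrep (hfilt _) hq
    · have : getN (idxs.map (messyOutsN jX w v (rowRepN T) (⟨tk, htk⟩ : Ty).val)) k ([] : List ℕ) = [] := by
        simp only [idxs, List.map]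
        match k, hk with
        | n + 15, _ => simp [getN]
      rw [this] at hq; simp at hq
  split at hq
  · exact hclean _ _ _ q hq
  · simp only [List.mem_singleton] at hq; subst hq; exact hrep _ htk
  · exact hclean _ _ _ q hq
  · exact hmessy _ _ _ _ q hq

/-- Members of `outsZ` are indices. [this work] -/
theorem outsZ_lt (πX : Ty) (p : Prog) (T : List (List ℤ)) {tk : ℕ} (htk : tk < 15) (ps : List ℕ) :
    ∀ q ∈ outsZ πX p T tk ps, q < 15 := by
  intro q hq
  unfold outsZ at hq
  have hrep : ∀ q, q < 15 → colRepN T q < 15 := fun q h => colRepN_lt T h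
  have hfilt : ∀ (P : ℕ → Bool), ∀ q ∈ idxs.filter P, q ∈ idxs := fun P q h => (List.mem_filter.1 h).1
  have hclean : ∀ (jX w k : ℕ), ∀ q ∈ getN (cleanTabN jX w (colRepN T)) k [], q < 15 := by
    intro jX w k q hq
    by_cases hk : k < 15
    · rw [cleanTabN, show k = (⟨k, hk⟩ : Ty).val from rfl, getN_idxs_map] at hq
      exact lt_of_mem_map_rep hrep (hfilt _) hq
    · have : getN (cleanTabN jX w (colRepN T)) k ([] : List ℕ) = [] := by
        rw [cleanTabN]; simp only [idxs, List.map]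
        match k, hk with
        | n + 15, _ => simp [getN]
      rw [this] at hq; simp at hq
  have hmessy : ∀ (jX w v k : ℕ), ∀ q ∈ getN (getN (messyTabN jX w v (colRepN T)) tk []) k [], q < 15 := by
    intro jX w v k q hq
    rw [messyTabN, show tk = (⟨tk, htk⟩ : Ty).val from rfl, getN_idxs_map] at hq
    by_cases hk : k < 15
    · rw [show k = (⟨k, hk⟩ : Ty).val from rfl, getN_idxs_map] at hq
      exact lt_of_mem_map_rep hrep (hfilt _) hq
    · have : getN (idxs.map (messyOutsN jX w v (colRepN T) (⟨tk, htk⟩ : Ty).val)) k ([] : List ℕ) = [] := by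
        simp only [idxs, List.map]
        match k, hk with
        | n + 15, _ => simp [getN]
      rw [this] at hq; simp at hq
  split at hq
  · simp only [List.mem_singleton] at hq; subst hq; exact hrep _ htk
  · exact hclean _ _ _ q hq
  · exact hmessy _ _ _ _ q hq
  · exact hclean _ _ _ q hq

/-- **The real `Y`-output's representative is listed.** [this work] -/
theorem rep_mem_outsY (c : Cert) (p : Prog) (T : List (List ℤ)) (hU : c.RS[p.iU]? = some p.U)
    (hV : p.kind.val < 2 ∨ c.RS[p.iV]? = some {p.v}) (x : Fin 3 → Finset (Sym2 V)) :
    rowRepN T (ftype τ (p.out τ x 1)).val ∈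
      outsY (ftype τ (x 0)) p T (ftype τ (x 1)).val (c.RS.map fun U' => (realP τ (x 0) (x 1) U').val) := by
  have h0 := getN_realStN τ c (x 0) (x 1) hU
  unfold outsY
  match hk : p.kind with
  | 0 =>
    simp only [h0, cleanTabN, getN_idxs_map, cleanOutsN]
    refine List.mem_map.2 ⟨_, List.mem_filter.2 ⟨mem_idxs _, ?_⟩, rfl⟩
    rw [jt_val, jt_val]; simp only [Prog.out, hk, psi1_one]
    exact admCleanN_of_admClean (admClean_ftype τ (x 0) (x 1) p.U)
  | 1 =>
    simp only [List.mem_singleton, Prog.out, hk, psi2_one]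
  | 2 =>
    simp only [h0, cleanTabN, getN_idxs_map, cleanOutsN]
    refine List.mem_map.2 ⟨_, List.mem_filter.2 ⟨mem_idxs _, ?_⟩, rfl⟩
    rw [jt_val, jt_val]; simp only [Prog.out, hk, psi3_one]
    exact admCleanN_of_admClean (admClean_ftype τ (x 0) (x 1) p.U)
  | 3 =>
    have hV' : c.RS[p.iV]? = some {p.v} := by
      rcases hV with hV | hV
      · rw [hk] at hV; exact absurd hV (by decide)
      · exact hV
    have h1 := getN_realStN τ c (x 0) (x 1) hV'
    simp only [h1, messyTabN, getN_idxs_map, messyOutsN]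
    refine List.mem_map.2 ⟨_, List.mem_filter.2 ⟨mem_idxs _, ?_⟩, rfl⟩
    rw [jt_val, jt_val, jt_val]; simp only [Prog.out, hk, psi4_one]
    exact admMessyN_of_admMessy (admMessy_ftype τ (x 0) (x 1) p.U p.v)

/-- **The real `Z`-output's representative is listed.** [this work] -/
theorem rep_mem_outsZ (c : Cert) (p : Prog) (T : List (List ℤ)) (hU : c.RS[p.iU]? = some p.U)
    (hV : p.kind.val < 2 ∨ c.RS[p.iV]? = some {p.v}) (x : Fin 3 → Finset (Sym2 V)) :
    colRepN T (ftype τ (p.out τ x 2)).val ∈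
      outsZ (ftype τ (x 0)) p T (ftype τ (x 2)).val (c.RS.map fun U' => (realP τ (x 0) (x 2) U').val) := by
  have h0 := getN_realStN τ c (x 0) (x 2) hU
  unfold outsZ
  match hk : p.kind with
  | 0 =>
    simp only [List.mem_singleton, Prog.out, hk, psi1_two]
  | 1 =>
    simp only [h0, cleanTabN, getN_idxs_map, cleanOutsN]
    refine List.mem_map.2 ⟨_, List.mem_filter.2 ⟨mem_idxs _, ?_⟩, rfl⟩
    rw [jt_val, jt_val]; simp only [Prog.out, hk, psi2_two]
    exact admCleanN_of_admClean (admClean_ftype τ (x 0) (x 2) p.U)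
  | 2 =>
    have hV' : c.RS[p.iV]? = some {p.v} := by
      rcases hV with hV | hV
      · rw [hk] at hV; exact absurd hV (by decide)
      · exact hV
    have h1 := getN_realStN τ c (x 0) (x 2) hV'
    simp only [h1, messyTabN, getN_idxs_map, messyOutsN]
    refine List.mem_map.2 ⟨_, List.mem_filter.2 ⟨mem_idxs _, ?_⟩, rfl⟩
    rw [jt_val, jt_val, jt_val]; simp only [Prog.out, hk, psi3_two]
    exact admMessyN_of_admMessy (admMessy_ftype τ (x 0) (x 2) p.U p.v)
  | 3 =>
    simp only [h0, cleanTabN, getN_idxs_map, cleanOutsN]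
    refine List.mem_map.2 ⟨_, List.mem_filter.2 ⟨mem_idxs _, ?_⟩, rfl⟩
    rw [jt_val, jt_val]; simp only [Prog.out, hk, psi4_two]
    exact admCleanN_of_admClean (admClean_ftype τ (x 0) (x 2) p.U)

/-- A nested list tabulates a pair potential. [this work] -/
def TabOK (f : Ty → Ty → ℤ) (T : List (List ℤ)) : Prop := ∀ s t : Ty, get2 T s.val t.val = f s t

/-- **The coded sum bounds the real potentials.** [this work] -/
theorem sumLam_le_sumBestM (c : Cert) (x : Fin 3 → Finset (Sym2 V)) :
    ∀ (qs : List Prog) (TP : List (List (List ℤ))), List.Forall₂ (fun p T => TabOK p.lam T) qs TP →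
      (∀ p ∈ qs, c.RS[p.iU]? = some p.U ∧ (p.kind.val < 2 ∨ c.RS[p.iV]? = some {p.v})) →
      sumLam τ x qs ≤ sumBestM TP
        (encOuts (outsYL (ftype τ (x 0)) (ftype τ (x 1)).val (c.RS.map fun U' => (realP τ (x 0) (x 1) U').val) qs TP))
        (encOuts (outsZL (ftype τ (x 0)) (ftype τ (x 2)).val (c.RS.map fun U' => (realP τ (x 0) (x 2) U').val) qs TP))
  | [], _, List.Forall₂.nil, _ => le_rfl
  | p :: qs, T :: TP, List.Forall₂.cons hT hTP, h => by
    have hp := h p List.mem_cons_self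
    simp only [sumLam, outsYL, outsZL, sumBestM, withVal_eq]
    have hY := outsY_lt (ftype τ (x 0)) p T (ftype τ (x 1)).isLt (c.RS.map fun U' => (realP τ (x 0) (x 1) U').val)
    have hZ := outsZ_lt (ftype τ (x 0)) p T (ftype τ (x 2)).isLt (c.RS.map fun U' => (realP τ (x 0) (x 2) U').val)
    rw [encOuts_cons_mod hY, encOuts_cons_mod hZ, encOuts_cons_div hY, encOuts_cons_div hZ]
    refine add_le_add ?_ (sumLam_le_sumBestM c x qs TP hTP fun q hq => h q (List.mem_cons_of_mem _ hq))
    have hle := get2_le_bestM T hY hZ (rep_mem_outsY τ c p T hp.1 hp.2 x) (rep_mem_outsZ τ c p T hp.1 hp.2 x)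
    rw [get2_rowRepN, get2_colRepN, hT] at hle
    exact hle

/-- **SOUNDNESS OF THE SCALABLE CHECK at one input type.** [this work] -/
theorem Cert.soundN_at (c : Cert) (hwf : c.wf = true) (πX : Ty) {T0 : List (List ℤ)} {TP : List (List (List ℤ))}
    {LY LZ : List ℕ} (hT0 : TabOK (c.lam0 πX) T0) (hTP : List.Forall₂ (fun p T => TabOK p.lam T) c.progs TP)
    (hcov : c.coverN πX T0 TP LY LZ = true) (hpair : PairOK T0 TP LY LZ)
    (x : Fin 3 → Finset (Sym2 V)) (hx : ftype τ (x 0) = πX) : Sreal τ c x ≤ 0 := by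
  subst hx
  -- coverage gives the memberships of the two real codes
  simp only [Cert.coverN, Cert.coverNtk, List.all_eq_true, Bool.and_eq_true] at hcov
  have hY := mem_of_elemN (hcov _ (realStN_mem_statesN τ c (x 0) (x 1))).1
  have hZ := mem_of_elemN (hcov _ (realStN_mem_statesN τ c (x 0) (x 2))).2
  -- the pair condition bounds the value of that code pair
  have hv := hpair _ hY _ hZ
  -- and the value dominates `Sreal`
  have hprogs : ∀ p ∈ c.progs, c.RS[p.iU]? = some p.U ∧ (p.kind.val < 2 ∨ c.RS[p.iV]? = some {p.v}) := by
    intro p hp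
    simp only [Cert.wf, List.all_eq_true, Bool.and_eq_true, Bool.or_eq_true, decide_eq_true_iff] at hwf
    exact hwf p hp
  have hle := sumLam_le_sumBestM τ c x c.progs TP hTP hprogs
  have htY : rowRepN T0 (ftype τ (x 1)).val < 16 := lt_trans (rowRepN_lt T0 (ftype τ (x 1)).isLt) (by norm_num)
  have htZ : colRepN T0 (ftype τ (x 2)).val < 16 := lt_trans (colRepN_lt T0 (ftype τ (x 2)).isLt) (by norm_num)
  simp only [realStN, codeY, codeZ, valM, unmix_mix, valCore, withVal_eq, Nat.add_mul_mod_self_left, Nat.mod_eq_of_lt htY,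
    Nat.mod_eq_of_lt htZ, Nat.add_mul_div_left _ _ (show 0 < 16 by norm_num), Nat.div_eq_of_lt htY,
    Nat.div_eq_of_lt htZ, zero_add] at hv
  rw [get2_rowRepN, get2_colRepN, hT0] at hv
  rw [Sreal]
  linarith

end Real

/-- **The scalable check passes at input type `πX`**: some tables tabulate the potentials, and some code lists are
covering and satisfy the pair condition.  Certificate files prove this per `πX` from literal code lists by `decide +kernel`
(tables: `bucket2` / `bucket3` of the entry lists, correct by `get2_bucket2` / `get2_bucket3`). [this work] -/
def Cert.OkAt (c : Cert) (πX : Ty) : Prop :=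
  ∃ (T0 : List (List ℤ)) (TP : List (List (List ℤ))) (LY LZ : List ℕ), TabOK (c.lam0 πX) T0 ∧
    List.Forall₂ (fun p T => TabOK p.lam T) c.progs TP ∧ c.coverN πX T0 TP LY LZ = true ∧ PairOK T0 TP LY LZ

/-- Assembling the fifteen input types. [this work] -/
theorem Cert.okAt_all (c : Cert) (h0 : c.OkAt 0) (h1 : c.OkAt 1) (h2 : c.OkAt 2) (h3 : c.OkAt 3) (h4 : c.OkAt 4)
    (h5 : c.OkAt 5) (h6 : c.OkAt 6) (h7 : c.OkAt 7) (h8 : c.OkAt 8) (h9 : c.OkAt 9) (h10 : c.OkAt 10) (h11 : c.OkAt 11)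
    (h12 : c.OkAt 12) (h13 : c.OkAt 13) (h14 : c.OkAt 14) : ∀ πX, c.OkAt πX := by
  intro πX
  fin_cases πX
  exacts [h0, h1, h2, h3, h4, h5, h6, h7, h8, h9, h10, h11, h12, h13, h14]

/-- The tables a certificate file uses: one-pass tabulations of the entry lists. [this work] -/
theorem tabOK_bucket2 (l : List (Ty × Ty × ℤ)) : TabOK (lookup2 l) (bucket2 l) := fun s t => get2_bucket2 l s t

/-- Companion for the input potential at a fixed input type. [this work] -/
theorem tabOK_bucket3 (l : List (Ty × Ty × Ty × ℤ)) (πX : Ty) : TabOK (lookup3 l πX) (getN (bucket3 l) πX.val []) :=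
  fun s t => get2_bucket3 l πX s t

section Real2

variable {V : Type*} [Fintype V] [DecidableEq V] (τ : Fin 4 → V)

/-- **SOUNDNESS OF THE SCALABLE CHECK.**  Well-formedness and the check at all 15 input types give `S ≤ 0` at every
configuration triple of every finite graph, for every placement of the terminals. [this work] -/
theorem Cert.soundN (c : Cert) (hwf : c.wf = true) (h : ∀ πX, c.OkAt πX) (x : Fin 3 → Finset (Sym2 V)) :
    Sreal τ c x ≤ 0 := by
  obtain ⟨T0, TP, LY, LZ, hT0, hTP, hcov, hpair⟩ := h (ftype τ (x 0))
  exact c.soundN_at τ hwf (ftype τ (x 0)) hT0 hTP hcov hpair x rfl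

/-- From the pointwise bound to the expectation (part III's `ES_nonpos_of_check` with `Sreal ≤ 0` as hypothesis). [this work] -/
theorem ES_nonpos_of_Sreal (c : Cert) (hS : ∀ x : Fin 3 → Finset (Sym2 V), Sreal τ c x ≤ 0) {p : Sym2 V → ℝ}
    (hp0 : ∀ i, 0 ≤ p i) (hp1 : ∀ i, p i ≤ 1) (D : Finset (Sym2 V)) : ES c (fun t => PrW D p (tyEv τ t)) ≤ 0 := by
  rw [← sum_wt3W_Sreal τ p D c]
  exact Finset.sum_nonpos fun x _ =>
    mul_nonpos_of_nonneg_of_nonpos (DTree3.wt3W_nonneg D hp0 hp1 x) (by exact_mod_cast hS x)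

end Real2

end SwitchRelax

end Summit.CriticalPhenomena.PercolationContinuityZ3.Theorems
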